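import Summits.ValiantsHypothesis.ValiantsHypothesis.Theses.DefinabilityGap
import Summits.ValiantsHypothesis.ValiantsHypothesis.Theorems.DefinabilityGapK2cVPSPACEbRung
import HarnessLib

/-!
# DefinabilityGap — the aside `KIAnnihilatorInVPSPACE` HOLDS (item `stmt-ValiantsHypothesis-23738`)

decomp-valiant lens 5, gen 12 (ledger hygiene of the TERMINAL lineage N5). The route's aside K2psp
`KIAnnihilatorInVPSPACE` — the `VPSPACE_b(ℂ)` rung of the attacked crux K2c on the definability ladder: the planted
Kabanets–Impagliazzo permanent map `G_m` has, for all large `m`, a NONZERO annihilator family in `VPSPACE_b` over `ℂ`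
(`Literature.Barriers.ValiantsHypothesis.IsVPSPACEbFamily ℂ`) — is a THEOREM of the tree:
`Theorems/DefinabilityGapK2cVPSPACEbRung.k2c_vpspaceb_rung` (unconditional; Chatterjee–Tengse 2023 Thm. 3.1 / Lemma 4.7
engine `CT23Lemma47.intEngine` PROVED in `Literature/Barriers/ValiantsHypothesis/CT23Lemma47Holds`, applied to the
integer, constant-free, multilinear annihilators of `DefinabilityGapK2cVPSPACE0Rung.k2c_vpspace0b_rung`, read over `ℂ`).
The route objects `qOf m := leastPrimeGe (m·m+1)` and `kiPer m := kiGenerator (perPad ℂ _) (quadDesign m)` are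
definitionally the inlined terms of the item's signature (`Theorems/DefinabilityGapAffineRung`, header), so the item is
closed by destructuring the rung. No new definitions; standard axioms.
-/

noncomputable section

set_option linter.dupNamespace false

namespace Summit.ValiantsHypothesis.ValiantsHypothesis.Theorems.DefinabilityGapK2pspAside

/-- **`KIAnnihilatorInVPSPACE` holds** (K2psp): the planted KI permanent map has a nonzero `VPSPACE_b(ℂ)` annihilator
family for all large `m`. [cite: ChatterjeeTengse2023, Def. 2.22, Thm. 3.1 and Lemma 4.7; KabanetsImpagliazzo2003,
Thm. 7.7] -/
theorem kiAnnihilatorInVPSPACE_holds :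
    Summit.ValiantsHypothesis.ValiantsHypothesis.Theses.DefinabilityGap.KIAnnihilatorInVPSPACE := by
  obtain ⟨P, hP, m₁, h⟩ :=
    Summit.ValiantsHypothesis.ValiantsHypothesis.Theorems.DefinabilityGapK2cVPSPACEbRung.k2c_vpspaceb_rung
  exact ⟨P, hP, m₁, h⟩

end Summit.ValiantsHypothesis.ValiantsHypothesis.Theorems.DefinabilityGapK2pspAside

end
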